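import Summits.Ventures.HodgeRepro2.T6A2Proj
import Summits.Ventures.HodgeRepro2.A2Avoidance

/-!
# T6A2Main — sub-claim A2 in kernel over `T6Interface` v0: (S2) the F-compatible algebraic (1,1)-class θ
and (S3) the algebraicity of `y = z ⋆ θ⁴` (TIER4 §A2, owner p6, formalised as scored)

Cell pub-hodge-repro2, Tier 6 (README §10), seat t6-p2 (A2 owner). Proof lane (no new definition).

* `exists_theta_vertex` — (S2) AT ONE VERTEX: for `K` Galois CM (instance arguments, per the lead's ruling
  STATUS l. 4259 (iv)), a half-system `τ` of the conjugate pairs and eigenline generators `e` (the A1 data,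
  taken as hypotheses until A1 lands), the vertex `i` carries `θ_i ∈ H²(A_i, ℚ)` with `θ_i ∈ D.Alg 1` (by the
  interface's Lefschetz (1,1) field `alg_lefschetz`, TIER4 Cor. A4.2.5) and `extC θ_i = Σ_ν c_ν E_{i,ν}`,
  every `c_ν ≠ 0` (TIER4 (A4.2.7): Lemma A4.2.2's rational projector `Q([x]^*)` for a separating `x`
  (Lemma A4.2.1, `T6A2Conj.exists_separates`) applied to a class `θ₀` avoiding the three coordinate kernels
  (Lemma A4.2.6, p6's `A2Avoidance.exists_notMem_three`)).
* `exists_theta` — (S2): `θ = Σ_i θ_i ∈ D.Alg 1 ∩ H²(B, ℚ)` with `extC θ = Σ_{i,ν} c_{i,ν} E_{i,ν}`, all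
  `c_{i,ν} ≠ 0` (the F-compatible class of TIER4 (A4.2.7); the form A3 consumes, STATUS l. 4230 [A2]).
* `pont_z_pow_four_mem_alg` — (S3): `y = pont z (θ^4) ∈ D.Alg 2` for `θ ∈ D.Alg 1` (TIER4 (A4.3.3), from
  the interface fields `alg_mul`, `z_alg`, `alg_pont`); `pow_mem_alg`.
* `A2_main` — the sub-goal's top theorem (TARGET-T6 §7(a)): (S2) ∧ (S3) together.
* `exists_emb_eq`, `exists_generators` — the A1 → A2 glue: for `K/ℚ` Galois every complex embedding is
  `τ₁ ∘ g` (`AlgHom.restrictNormal`), and A1's «each eigenline is a line, the eigenlines span `K ⊗ ℂ`» yields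
  the generator binders `e`, `he`, `hne`, `hspan` of `A2_main`.

No `sorry`; `#print axioms` ⊆ {propext, Classical.choice, Quot.sound}.
-/
namespace Summit.Ventures.HodgeRepro2.T6.A2Main

open Summit.Ventures.HodgeRepro2.T6 Summit.Ventures.HodgeRepro2.T6.A2Model
  Summit.Ventures.HodgeRepro2.T6.A2Theta Summit.Ventures.HodgeRepro2.T6.A2Conj
  Summit.Ventures.HodgeRepro2.T6.A2Proj NumberField Polynomial

variable (K : Type*) [Field K] [NumberField K] [IsCMField K]
variable [DecidableEq K] [DecidableEq (K ≃ₐ[ℚ] K)]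
variable (τ₁ : K →+* ℂ)


/-! ### The A1 → A2 glue: embeddings through `Gal(K/ℚ)` and the eigenline generators -/

omit [IsCMField K] [DecidableEq K] [DecidableEq (K ≃ₐ[ℚ] K)] in
/-- For `K/ℚ` Galois, every complex embedding is `τ₁ ∘ g` for some `g ∈ Gal(K/ℚ)` (the one Galois fact the
A1 → A2 glue needs: `Hom(K, ℂ) = {τ₁ ∘ g}`). -/
theorem exists_emb_eq [IsGalois ℚ K] (τ₁ σ : K →+* ℂ) : ∃ g : K ≃ₐ[ℚ] K, σ = emb K τ₁ g := by
  letI : Algebra K ℂ := τ₁.toAlgebra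
  haveI : IsScalarTower ℚ K ℂ :=
    IsScalarTower.of_algebraMap_eq fun q => (RingHom.map_rat_algebraMap τ₁ q).symm
  let φ : K →ₐ[ℚ] ℂ := RingHom.equivRatAlgHom σ
  let ψ : K →ₐ[ℚ] K := φ.restrictNormal K
  have hψ : ∀ x, τ₁ (ψ x) = σ x := fun x => AlgHom.restrictNormal_commutes φ K x
  refine ⟨AlgEquiv.ofBijective ψ (Algebra.IsAlgebraic.algHom_bijective ψ), ?_⟩
  ext x
  exact (hψ x).symm


omit [IsCMField K] [DecidableEq K] [DecidableEq (K ≃ₐ[ℚ] K)] in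
/-- The A1 → A2 glue for the eigenline generators: if every `σ`-eigenline of `K ⊗ ℂ` is a line `ℂ·v_σ` and the
eigenlines span `K ⊗ ℂ` (A1's `K ⊗ ℂ = ⊕_σ ℂ`), then, re-indexed by `Gal(K/ℚ)` through `τ₁`, the generators
`e g := v_{τ₁ ∘ g}` satisfy A2's binders: `e g ∈ eigenLineK (τ₁ ∘ g)`, `e g ≠ 0`, `span (range e) = ⊤`. -/
theorem exists_generators [IsGalois ℚ K] (τ₁ : K →+* ℂ)
    (hline : ∀ σ : K →+* ℂ, ∃ v : KC K, v ≠ 0 ∧ eigenLineK K σ = Submodule.span ℂ {v})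
    (hsup : ⨆ σ : K →+* ℂ, eigenLineK K σ = ⊤) :
    ∃ e : (K ≃ₐ[ℚ] K) → KC K, (∀ g, e g ∈ eigenLineK K (emb K τ₁ g)) ∧ (∀ g, e g ≠ 0) ∧
      Submodule.span ℂ (Set.range e) = ⊤ := by
  choose v hv using hline
  refine ⟨fun g => v (emb K τ₁ g), fun g => ?_, fun g => (hv _).1, ?_⟩
  · rw [(hv _).2]; exact Submodule.mem_span_singleton_self _
  · apply top_le_iff.mp
    rw [← hsup]
    refine iSup_le fun σ => ?_
    rw [(hv σ).2, Submodule.span_le]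
    rintro _ rfl
    obtain ⟨g, rfl⟩ := exists_emb_eq K τ₁ σ
    exact Submodule.subset_span ⟨g, rfl⟩


/-- (S2) AT ONE VERTEX (TIER4 A4.2.2, A4.2.5, A4.2.6, (A4.2.7)): for `K` Galois CM with a half-system `τ`
of its conjugate pairs and eigenline generators `e` (the A1 data), the vertex `i` carries a rational class
`θ_i ∈ H²(A_i, ℚ)`, ALGEBRAIC by Lefschetz (1,1) (the interface field `alg_lefschetz`), whose
complexification is `Σ_ν c_ν E_{i,ν}` with every `c_ν ≠ 0` (`E_{i,ν} = ι(e_{i,τ_ν}) ∧ ι(e_{i,τ̄_ν})`). -/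
theorem exists_theta_vertex [IsGalois ℚ K] (F : FaceSetting K) (D : TransferShadow F)
    (e : (K ≃ₐ[ℚ] K) → KC K) (he : ∀ g, e g ∈ eigenLineK K (emb K τ₁ g)) (hne : ∀ g, e g ≠ 0)
    (hspan : Submodule.span ℂ (Set.range e) = ⊤)
    (τ : Fin 3 → (K ≃ₐ[ℚ] K)) (hτcov : ∀ g, ∃ ν, g = τ ν ∨ g = (cc K).trans (τ ν))
    (hτdist : ∀ ν ν', τ ν' = τ ν ∨ τ ν' = (cc K).trans (τ ν) → ν' = ν) (i : Fin 4) :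
    ∃ θ ∈ vertexH2 K i, θ ∈ D.Alg 1 ∧ ∃ c : Fin 3 → ℂ, (∀ ν, c ν ≠ 0) ∧
      extC K θ = ∑ ν, c ν • planeGen K e i (τ ν, (cc K).trans (τ ν)) := by
  obtain ⟨x, hx⟩ := exists_separates K
  obtain ⟨Q, hQ⟩ := Summit.Ventures.HodgeRepro2.A2Galois.exists_polynomial_map_eq_lagrangeIndicator
    (Lam K x) (LamW K x) (Lam_stable K x) (LamW_stable K x)
  -- the three coordinate functionals on H²(A_i, ℚ) (TIER4 (A4.2.7): λ_{i,ν} restricted to D_i)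
  let φ : Fin 3 → (vertexH2 K i →ₗ[ℚ] HBC K) := fun ν =>
    (((proj1 K τ₁ x (τ ν)).restrictScalars ℚ).comp (extC K).toLinearMap).comp (vertexH2 K i).subtype
  set E : Fin 3 → HBC K := fun ν => planeGen K e i (τ ν, (cc K).trans (τ ν)) with hE
  have hEne : ∀ ν, E ν ≠ 0 := fun ν => planeGen_ne_zero K τ₁ e he hne i (cc_trans_ne K (τ ν)).symm
  have hproj1E : ∀ ν, proj1 K τ₁ x (τ ν) (E ν) = E ν := by
    intro ν
    rw [proj1, Summit.Ventures.HodgeRepro2.T6.A2Projector.aeval_apply_of_mem_eigenspace _ (planeGen_mem_eigenspace K τ₁ e he x i _),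
      eval_map_lagrangeIndicator_ringHom K τ₁ _ _ (mem_Lam_of_ne K x (cc_trans_ne K (τ ν)).symm),
      if_pos (Finset.mem_singleton_self _), one_smul]
  -- the functionals are non-zero (LEMMA A4.2.6's hypothesis): π_ν is the identity on E_ν ≠ 0, and E_ν lies
  -- in the ℂ-span of the complexified H²(A_i, ℚ)
  have hφ : ∀ ν, φ ν ≠ 0 := by
    intro ν hφν
    apply hEne ν
    have hker : Submodule.span ℂ ((extC K) '' (vertexH2 K i : Set (HB K))) ≤
        LinearMap.ker (proj1 K τ₁ x (τ ν)) := by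
      rw [Submodule.span_le]
      rintro _ ⟨θ, hθ, rfl⟩
      have := congrArg (fun f => f ⟨θ, hθ⟩) hφν
      simpa [φ] using this
    have hEmem : E ν ∈ Submodule.span ℂ ((extC K) '' (vertexH2 K i : Set (HB K))) :=
      gen1C_mul_gen1C_mem_span K i _ _
    have := hker hEmem
    rw [LinearMap.mem_ker, hproj1E] at this
    exact this
  -- LEMMA A4.2.6: avoid the three kernels
  obtain ⟨θ₀, hθ₀0, hθ₀1, hθ₀2⟩ := Summit.Ventures.HodgeRepro2.A2Avoidance.exists_notMem_three
    (LinearMap.ker (φ 0)) (LinearMap.ker (φ 1)) (LinearMap.ker (φ 2))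
    (Summit.Ventures.HodgeRepro2.A2Avoidance.ker_ne_top_of_ne_zero _ (hφ 0))
    (Summit.Ventures.HodgeRepro2.A2Avoidance.ker_ne_top_of_ne_zero _ (hφ 1))
    (Summit.Ventures.HodgeRepro2.A2Avoidance.ker_ne_top_of_ne_zero _ (hφ 2))
  have hnotker : ∀ ν, θ₀ ∉ LinearMap.ker (φ ν) := by
    intro ν
    fin_cases ν
    · exact hθ₀0
    · exact hθ₀1
    · exact hθ₀2
  have hθ₀ : ∀ ν, proj1 K τ₁ x (τ ν) (extC K θ₀.1) ≠ 0 := by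
    intro ν h
    apply hnotker ν
    rw [LinearMap.mem_ker]
    simpa [φ] using h
  obtain ⟨a, ha⟩ := exists_coeffs K e hspan i θ₀.2
  -- θ := Q([x]^*) θ₀ (LEMMA A4.2.2: the rational projector applied to θ₀)
  set θ := aeval (pullEndo K x).toLinearMap Q θ₀.1 with hθdef
  have hθmem : θ ∈ vertexH2 K i := aeval_pullEndo_mem_vertexH2 K x i Q θ₀.2
  have hQmap : Q.map (algebraMap ℚ ℂ) =
      (Summit.Ventures.HodgeRepro2.A2Galois.lagrangeIndicator (Lam K x) (LamW K x)).map τ₁ := by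
    rw [← hQ, Polynomial.map_map]
    congr 1
    exact RingHom.ext fun q => (RingHom.map_rat_algebraMap τ₁ q).symm
  have hextC : extC K θ = ∑ ν, proj1 K τ₁ x (τ ν) (extC K θ₀.1) := by
    rw [hθdef, extC_aeval, hQmap, ← projW, projW_eq_sum_proj1 K τ₁ hx τ hτcov hτdist,
      LinearMap.sum_apply]
  let c : Fin 3 → ℂ := fun ν => a (τ ν, (cc K).trans (τ ν)) - a ((cc K).trans (τ ν), τ ν)
  have hcE : ∀ ν, proj1 K τ₁ x (τ ν) (extC K θ₀.1) = c ν • E ν := by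
    intro ν
    rw [← ha, proj1_sum_planeGen K τ₁ e he hx]
  refine ⟨θ, hθmem, ?_, c, ?_, ?_⟩
  · -- Lefschetz (1,1) on the vertex (the interface field): extC θ ∈ H^{1,1}
    apply D.alg_lefschetz θ (vertexH2_le_degB K i hθmem)
    rw [hextC]
    refine Submodule.sum_mem _ fun ν _ => ?_
    rw [hcE]
    refine Submodule.smul_mem _ _ ?_
    have hxor := (F.face.1 i) (emb K τ₁ (τ ν))
    rw [conjugate_emb] at hxor
    rcases hxor with ⟨h1, h2⟩ | ⟨h1, h2⟩
    · exact (ι_mul_ι_mem_hodge11 F h1 h2 (single_mem_eigenLine K i (he _))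
        (single_mem_eigenLine K i (he _))).1
    · exact (ι_mul_ι_mem_hodge11 F h1 h2 (single_mem_eigenLine K i (he _))
        (single_mem_eigenLine K i (he _))).2
  · intro ν hc
    apply hθ₀ ν
    rw [hcE, hc, zero_smul]
  · rw [hextC]
    exact Finset.sum_congr rfl fun ν _ => hcE ν


/-- (S2): the F-compatible algebraic class `θ = Σ_i θ_i ∈ Alg¹(B) ∩ H²(B, ℚ)` with
`extC θ = Σ_{i,ν} c_{i,ν} E_{i,ν}`, every `c_{i,ν} ≠ 0` (TIER4 (A4.2.7): `θ = Σ_i pr_i^* θ_i`). -/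
theorem exists_theta [IsGalois ℚ K] (F : FaceSetting K) (D : TransferShadow F)
    (e : (K ≃ₐ[ℚ] K) → KC K) (he : ∀ g, e g ∈ eigenLineK K (emb K τ₁ g)) (hne : ∀ g, e g ≠ 0)
    (hspan : Submodule.span ℂ (Set.range e) = ⊤)
    (τ : Fin 3 → (K ≃ₐ[ℚ] K)) (hτcov : ∀ g, ∃ ν, g = τ ν ∨ g = (cc K).trans (τ ν))
    (hτdist : ∀ ν ν', τ ν' = τ ν ∨ τ ν' = (cc K).trans (τ ν) → ν' = ν) :
    ∃ θ ∈ D.Alg 1, θ ∈ degB K 2 ∧ ∃ c : Fin 4 → Fin 3 → ℂ, (∀ i ν, c i ν ≠ 0) ∧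
      extC K θ = ∑ i, ∑ ν, c i ν • planeGen K e i (τ ν, (cc K).trans (τ ν)) := by
  choose θ hθ using fun i => exists_theta_vertex K τ₁ F D e he hne hspan τ hτcov hτdist i
  choose c hc using fun i => (hθ i).2.2
  refine ⟨∑ i, θ i, Submodule.sum_mem _ fun i _ => (hθ i).2.1,
    Submodule.sum_mem _ fun i _ => vertexH2_le_degB K i (hθ i).1, c, fun i ν => (hc i).1 ν, ?_⟩
  rw [map_sum]
  exact Finset.sum_congr rfl fun i _ => (hc i).2

omit [IsCMField K] [DecidableEq K] [DecidableEq (K ≃ₐ[ℚ] K)] in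
/-- (S3) in the interface's terms (TIER4 A2 (A4.3.3)): for θ ∈ Alg 1, the class
y := z ⋆ θ⁴ = pont z (θ^4) is algebraic, y ∈ Alg 2 — from `alg_mul` (θ⁴ ∈ Alg 4), `z_alg` (z ∈ Alg 10) and
`alg_pont` (10 + 4 − 12 = 2). -/
theorem pont_z_pow_four_mem_alg {F : FaceSetting K} (D : TransferShadow F) {θ : HB K}
    (hθ : θ ∈ D.Alg 1) :
    D.pont D.z (θ ^ 4) ∈ D.Alg 2 := by
  have h2 : θ ^ 2 ∈ D.Alg 2 := by rw [pow_two]; exact D.alg_mul hθ hθ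
  have h4 : θ ^ 4 ∈ D.Alg 4 := by
    have h : θ ^ 4 = θ ^ 2 * θ ^ 2 := by rw [← pow_add]
    rw [h]; exact D.alg_mul h2 h2
  exact D.alg_pont D.z_alg h4

omit [IsCMField K] [DecidableEq K] [DecidableEq (K ≃ₐ[ℚ] K)] in
/-- Powers of an algebraic class are algebraic: θ ∈ Alg k ⇒ θ^n ∈ Alg (n k). -/
theorem pow_mem_alg {F : FaceSetting K} (D : TransferShadow F) {k : ℕ} {θ : HB K} (hθ : θ ∈ D.Alg k)
    (n : ℕ) :
    θ ^ n ∈ D.Alg (n * k) := by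
  induction n with
  | zero => simpa using D.alg_one
  | succ n ih =>
    rw [pow_succ, Nat.succ_mul]
    exact D.alg_mul ih hθ


/-- THE SUB-GOAL'S TOP THEOREM (TARGET-T6 §7(a)): (S2) ∧ (S3) — an F-compatible algebraic (1,1)-class θ exists,
and `y = z ⋆ θ⁴` is algebraic. The A1 data (`τ₁`, `e`, `τ`) are hypotheses; `[IsGalois ℚ K]` and
`[IsCMField K]` are instance arguments (TIER4 A0.1: `F` a Galois CM field). -/
theorem A2_main [IsGalois ℚ K] (F : FaceSetting K) (D : TransferShadow F)
    (e : (K ≃ₐ[ℚ] K) → KC K) (he : ∀ g, e g ∈ eigenLineK K (emb K τ₁ g)) (hne : ∀ g, e g ≠ 0)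
    (hspan : Submodule.span ℂ (Set.range e) = ⊤)
    (τ : Fin 3 → (K ≃ₐ[ℚ] K)) (hτcov : ∀ g, ∃ ν, g = τ ν ∨ g = (cc K).trans (τ ν))
    (hτdist : ∀ ν ν', τ ν' = τ ν ∨ τ ν' = (cc K).trans (τ ν) → ν' = ν) :
    ∃ θ ∈ D.Alg 1, θ ∈ degB K 2 ∧ D.pont D.z (θ ^ 4) ∈ D.Alg 2 ∧
      ∃ c : Fin 4 → Fin 3 → ℂ, (∀ i ν, c i ν ≠ 0) ∧
        extC K θ = ∑ i, ∑ ν, c i ν • planeGen K e i (τ ν, (cc K).trans (τ ν)) := by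
  obtain ⟨θ, hθ, hdeg, c, hc, hext⟩ := exists_theta K τ₁ F D e he hne hspan τ hτcov hτdist
  exact ⟨θ, hθ, hdeg, pont_z_pow_four_mem_alg K D hθ, c, hc, hext⟩

end Summit.Ventures.HodgeRepro2.T6.A2Main
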